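/-
Copyright (c) 2026. All rights reserved.
Released under Apache 2.0 license as described in the file LICENSE.
Authors: abc-iut cell, W6 cone prover seat abc-iut-w6-d027 (gen 0) (proof-only: the commutative
diagram of [AbsTopIII] Def 5.4 (iii) at the Galois-side model `k~ = 𝒪_k̄^× ⧸ 𝒪_k̄^μ`).
-/
import Literature.AnabelianGeometry.AbsoluteAnabelian.GaloisPadicLogShellBridge
import Mathlib.FieldTheory.IsAlgClosed.Basic
import HarnessLib

/-!
# [AbsTopIII] Def 5.4 (iii): the commutative diagram `𝒪_k̄^× ↪ k̄^× ↪ k̄` over `k~ → k~ ↪ (k̄^×)^pf`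

S. Mochizuki, *Topics in absolute anabelian geometry III* [MochizukiAbsTopIII2015], Def 5.4 (iii),
manuscript p. 126 l. 17–33 (own render `paper:url-5493eb38cbb7` p0126.txt): "Consider, in the notation
of Definition 3.1, (iv), the commutative diagram of natural maps
`𝒪_k̄^× ↪ k̄^× ↪ k̄` (space-link) over `k~ →(id) k~ ↪ (k̄^×)^pf` (post-log), with vertical arrows the
shell-arrow `𝒪_k̄^× → k~` and `k̄^× → (k̄^×)^pf` — where we recall that `k~ := (𝒪_k̄^×)^pf` — a diagram
which determines an oriented graph `Γ⃗^log_non` …; `Γ⃗^⋉_non` [= `Γ⃗^log_non` minus the upper right-hand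
arrow `↪ k̄`] may be considered either as a diagram in the category `TS` or as a diagram in the
category `TS⊞` [i.e., relative to the additive topological group structure of the field `k~`] …
we write `ℐ*` for the image of `𝒪_k^× = (𝒪_k̄^×)^{Π_k} ⊆ 𝒪_k̄^×` via the left-hand vertical arrow of
the above diagram, i.e., in essence, the compact submodule constituted by the pre-log-shell discussed
in Definition 3.1, (iv) … `ℐ := (p*_k)⁻¹ · ℐ* ⊆ (k~)^{Π_k}`".

PROOF-ONLY companion (no definitions) of abc-iut-L4-t3's `LogFrobeniusGraphs.lean` (p404505: the
oriented graph `Γ⃗^log_non` as a REAL quiver, the node's kernel index `N_AbsTopIII_Def5_4_iii`) and of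
abc-iut-L6-d2's `GaloisPadicLogPerfection.lean` (the Galois-side objects: `𝒪_k̄^× = unitGroup k K ≤ k̄^×`,
`k~ = 𝒪_k̄^× ⧸ 𝒪_k̄^μ`, the shell-arrow `QuotientGroup.mk'`, `log_k̄ : k~ ⥲ k̄ = GaloisPadicLog.logEquiv`,
the image `invariantUnitClasses` of `𝒪_k^×` in `k~`), for ANY `L : GaloisPadicLog k K`.  It types, as
THEOREMS over Mathlib's `QuotientGroup` / `CommGroup.torsion` (nothing new is defined), the printed
clauses of Def 5.4 (iii) that concern the DIAGRAM itself, which the set-level files (`LogShells.lean`,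
`GaloisPadicLogShellBridge.lean`, `HolomorphicLogShellUnramified.lean`: `𝒪 ⊆ ℐ ⊆ k`, `p*`, the bijection
`1 + p*𝒪 ⥲ p*𝒪`, `𝒪 = ℐ` when unramified and `p` odd) do not spell out:

* `(k̄^×)^pf` is realised as `k̄^× ⧸ (k̄^×)^μ` (torsion quotient): for `k̄` algebraically closed every
  `n`-th power map on it is bijective (`ShellDiagram.pow_bijective_unitsModTorsion_closure`), so it IS
  the perfection in the sense of [FrdI] §0, exactly as `GaloisPadicLogPerfection` does for `k~`;
* the right-hand vertical arrow `k̄^× → (k̄^×)^pf` and the bottom arrow `k~ ↪ (k̄^×)^pf` (perfection of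
  the inclusion `𝒪_k̄^× ↪ k̄^×`) are `QuotientGroup.mk'` / `QuotientGroup.map`; **the square COMMUTES**
  (`ShellDiagram.square_comm`) and **`k~ ↪ (k̄^×)^pf` is INJECTIVE** (`ShellDiagram.perfMap_injective`:
  `𝒪_k̄^× ∩ (k̄^×)^μ = 𝒪_k̄^μ`, `ShellDiagram.torsion_unitGroup_eq_comap`);
* "diagram in `TS⊞`": every arrow of `Γ⃗^⋉_non` is exhibited as a group homomorphism (`→*`), while the
  removed space-link arrow `k̄^× ↪ k̄` is NOT additive (`ShellDiagram.units_val_not_additive`) — the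
  typed reason why only `Γ⃗^⋉_non`, not `Γ⃗^log_non`, is a `TS⊞`-diagram;
* "`ℐ*` = the image of `𝒪_k^×` via the left-hand vertical arrow … in essence … the pre-log-shell of
  Def 3.1 (iv)": read in `k̄` through `log_k̄`, the image of `invariantUnitClasses` IS abc-iut-L4-t2's
  `GaloisPadicLog.preLogShell` — as a SET, not only up to closure (`ShellDiagram.coe_preLogShell_eq_image`,
  `ShellDiagram.toAdd_logEquiv_image_invariantUnitClasses`), because `𝒪_k^×` is a group and `log_k̄` a
  homomorphism on it;
* "`ℐ ⊆ (k~)^{Π_k}`": every `k^×`-rescaling `c⁻¹ · ℐ*` (`c ∈ k`, e.g. `c = p*_k`) consists of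
  `G_k`-invariants (`ShellDiagram.smul_eq_self_of_mem_inv_smul_preLogShell`), hence lies in `k ⊆ k̄` for
  an MLF (`ShellDiagram.inv_smul_preLogShell_subset_range`, Galois descent via abc-iut-L6-d2's
  `GaloisPadicLog.coe_preLogShell_subset_range_algebraMap`).

Topologies on `k~` / `(k̄^×)^pf` (the `TS` half of the sentence) are not modelled on these abstract
quotients and are not asserted here.  Classical algebra over a refereed definition; nothing here bears on
[IUTchIII] Cor. 3.12; typed ≠ discharged; node AbsTopIII:Def5.4(iii) (cone interior, layer L4).
-/

set_option autoImplicit false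

noncomputable section

namespace Literature.AnabelianGeometry.AbsoluteAnabelian

namespace ShellDiagram

open scoped Pointwise

universe u

variable {k : Type u} [Field k] [ValuativeRel k] {K : Type u} [Field K] [Algebra k K]

/-! ## The perfection `(k̄^×)^pf = k̄^× ⧸ (k̄^×)^μ` and the arrows of the square -/

/-- `𝒪_k̄^× ∩ (k̄^×)^μ = 𝒪_k̄^μ`: a unit of `𝒪_k̄` is a root of unity in `𝒪_k̄^×` iff it is one in `k̄^×`
(the torsion of `unitGroup k K` is the pull-back of the torsion of `k̄^×` along the inclusion).
[cite: MochizukiAbsTopIII2015, Def 5.4 (iii) p. 126] -/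
theorem torsion_unitGroup_eq_comap :
    CommGroup.torsion (unitGroup k K) = (CommGroup.torsion Kˣ).comap (unitGroup k K).subtype :=
  (CommGroup.comap_torsion_of_injective (unitGroup k K).subtype_injective).symm

/-- The bottom right-hand arrow **`k~ = (𝒪_k̄^×)^pf → (k̄^×)^pf`** of the diagram (the perfection of the
inclusion `𝒪_k̄^× ↪ k̄^×`, realised on the torsion quotients) sends the class of a unit `u ∈ 𝒪_k̄^×` to its
class in `k̄^× ⧸ (k̄^×)^μ`. [cite: MochizukiAbsTopIII2015, Def 5.4 (iii) p. 126] -/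
theorem perfMap_mk (u : unitGroup k K) :
    QuotientGroup.map (CommGroup.torsion (unitGroup k K)) (CommGroup.torsion Kˣ) (unitGroup k K).subtype
        (CommGroup.le_comap_torsion _) (QuotientGroup.mk u) =
      QuotientGroup.mk (u : Kˣ) :=
  rfl

/-- **The diagram of Def 5.4 (iii) COMMUTES**: `𝒪_k̄^× ↪ k̄^× → (k̄^×)^pf` equals
`𝒪_k̄^× →(shell) k~ →(id, post-log ↦ pre-log copy) k~ ↪ (k̄^×)^pf`, as group homomorphisms.
[cite: MochizukiAbsTopIII2015, Def 5.4 (iii) p. 126] -/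
theorem square_comm :
    ((QuotientGroup.map (CommGroup.torsion (unitGroup k K)) (CommGroup.torsion Kˣ)
          (unitGroup k K).subtype (CommGroup.le_comap_torsion _)).comp
        ((MonoidHom.id _).comp (QuotientGroup.mk' (CommGroup.torsion (unitGroup k K))))) =
      (QuotientGroup.mk' (CommGroup.torsion Kˣ)).comp (unitGroup k K).subtype := by
  ext u
  rfl

/-- **`k~ ↪ (k̄^×)^pf` is injective** (the printed `↪`): a unit of `𝒪_k̄` whose class dies in
`k̄^× ⧸ (k̄^×)^μ` is a root of unity, i.e. its class in `k~ = 𝒪_k̄^× ⧸ 𝒪_k̄^μ` is already trivial.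
[cite: MochizukiAbsTopIII2015, Def 5.4 (iii) p. 126] -/
theorem perfMap_injective :
    Function.Injective
      (QuotientGroup.map (CommGroup.torsion (unitGroup k K)) (CommGroup.torsion Kˣ)
        (unitGroup k K).subtype (CommGroup.le_comap_torsion _)) := by
  rw [injective_iff_map_eq_one]
  intro x hx
  induction x using QuotientGroup.induction_on with
  | H u =>
    rw [perfMap_mk, QuotientGroup.eq_one_iff] at hx
    rw [QuotientGroup.eq_one_iff, torsion_unitGroup_eq_comap, Subgroup.mem_comap]
    exact hx

/-- The shell-arrow `𝒪_k̄^× → k~` is surjective and the two inclusions `𝒪_k̄^× ↪ k̄^×`, `k̄^× ↪ k̄`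
(space-link) are injective — the remaining "natural maps" of the diagram.
[cite: MochizukiAbsTopIII2015, Def 5.4 (iii) p. 126] -/
theorem shell_surjective_and_inclusions_injective :
    Function.Surjective (QuotientGroup.mk' (CommGroup.torsion (unitGroup k K))) ∧
      Function.Injective (unitGroup k K).subtype ∧ Function.Injective (Units.coeHom K) :=
  ⟨QuotientGroup.mk'_surjective _, (unitGroup k K).subtype_injective, Units.coeHom_injective⟩

/-- **`k̄^× ⧸ (k̄^×)^μ` IS the perfection `(k̄^×)^pf`** for `k̄` algebraically closed: every `n`-th power map
(`n ≥ 1`) on it is bijective (injective because the torsion quotient is torsion-free; surjective because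
`k̄` has all `n`-th roots). [cite: MochizukiAbsTopIII2015, Def 5.4 (iii) p. 126] -/
theorem pow_bijective_unitsModTorsion_closure [IsAlgClosed K] {n : ℕ} (hn : 0 < n) :
    Function.Bijective fun x : Kˣ ⧸ CommGroup.torsion Kˣ => x ^ n := by
  refine ⟨pow_left_injective hn.ne', fun y => ?_⟩
  induction y using QuotientGroup.induction_on with
  | H v =>
    obtain ⟨z, hz⟩ := IsAlgClosed.exists_pow_nat_eq (v : K) hn
    have hz0 : z ≠ 0 := by
      rintro rfl
      rw [zero_pow hn.ne'] at hz
      exact v.ne_zero hz.symm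
    refine ⟨QuotientGroup.mk (Units.mk0 z hz0), ?_⟩
    change (QuotientGroup.mk (Units.mk0 z hz0) : Kˣ ⧸ CommGroup.torsion Kˣ) ^ n = QuotientGroup.mk v
    rw [← QuotientGroup.mk_pow]
    congr 1
    ext
    rw [Units.val_pow_eq_pow_val, Units.val_mk0, hz]

/-- Consequently the torsion of `k̄^× ⧸ (k̄^×)^μ` is trivial, as for `k~` (`isOfFinOrder_unitsModTorsion_iff`).
[cite: MochizukiAbsTopIII2015, Def 5.4 (iii) p. 126] -/
theorem isOfFinOrder_unitsModTorsion_closure_iff (x : Kˣ ⧸ CommGroup.torsion Kˣ) :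
    IsOfFinOrder x ↔ x = 1 := by
  refine ⟨fun hx => ?_, fun hx => hx ▸ IsOfFinOrder.one⟩
  obtain ⟨n, hn, hxn⟩ := (isOfFinOrder_iff_pow_eq_one).mp hx
  exact pow_left_injective hn.ne' (by simpa using hxn)

/-- **"`Γ⃗^⋉_non` is a diagram in `TS⊞`, `Γ⃗^log_non` only in `TS`"**: the arrow removed to form `Γ⃗^⋉_non`,
the space-link inclusion `k̄^× ↪ k̄`, is NOT additive (`1 · 1 ≠ 1 + 1` in characteristic `0`), whereas
every other arrow above is a group homomorphism by construction.
[cite: MochizukiAbsTopIII2015, Def 5.4 (iii) p. 126] -/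
theorem units_val_not_additive [CharZero K] :
    ¬ ∀ x y : Kˣ, ((x * y : Kˣ) : K) = (x : K) + (y : K) := by
  intro h
  have h1 := h 1 1
  rw [mul_one, Units.val_one] at h1
  norm_num at h1

/-! ## `ℐ*`: the image of `𝒪_k^× = (𝒪_k̄^×)^{Π_k}` under the shell-arrow, read in `k̄` via `log_k̄` -/

variable (L : GaloisPadicLog k K)

/-- Under `log_k̄ : k~ ⥲ k̄`, the image `invariantUnitClasses` of `𝒪_k^×` by the shell-arrow is
`log_k̄(𝒪_k^×) ⊆ k̄`. [cite: MochizukiAbsTopIII2015, Def 5.4 (iii) p. 126] -/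
theorem toAdd_logEquiv_image_invariantUnitClasses :
    (fun y => Multiplicative.toAdd (L.logEquiv y)) '' invariantUnitClasses k K =
      L.log '' invariantUnits k K := by
  ext z
  simp only [invariantUnitClasses, Set.mem_image, Set.mem_setOf_eq]
  constructor
  · rintro ⟨_, ⟨u, hu, rfl⟩, rfl⟩
    exact ⟨((u : Kˣ) : K), hu, by rw [GaloisPadicLog.logEquiv_mk, toAdd_ofAdd]⟩
  · rintro ⟨x, hx, rfl⟩
    obtain ⟨u, rfl⟩ := exists_unitGroup_val_eq hx.1
    exact ⟨QuotientGroup.mk u, ⟨u, hx, rfl⟩, by rw [GaloisPadicLog.logEquiv_mk, toAdd_ofAdd]⟩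

/-- `𝒪_k^× = (𝒪_k̄^×)^{G_k}` is closed under products. [cite: MochizukiAbsTopIII2015, Def 5.4 (iii) p. 126] -/
theorem mul_mem_invariantUnits {x y : K} (hx : x ∈ invariantUnits k K) (hy : y ∈ invariantUnits k K) :
    x * y ∈ invariantUnits k K :=
  ⟨(unitSubmonoid k K).mul_mem hx.1 hy.1, fun σ => by rw [smul_mul', hx.2 σ, hy.2 σ]⟩

/-- `𝒪_k^× = (𝒪_k̄^×)^{G_k}` is closed under inverses. [cite: MochizukiAbsTopIII2015, Def 5.4 (iii) p. 126] -/
theorem inv_mem_invariantUnits {x : K} (hx : x ∈ invariantUnits k K) : x⁻¹ ∈ invariantUnits k K :=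
  ⟨inv_mem_unitSubmonoid hx.1, fun σ => by rw [AlgEquiv.smul_def, map_inv₀, ← AlgEquiv.smul_def, hx.2 σ]⟩

/-- `log_k̄ (x⁻¹) = - log_k̄ x` on `𝒪_k̄^×`. [cite: MochizukiAbsTopIII2015, Def 5.4 (iii) p. 126] -/
theorem log_inv {x : K} (hx : x ∈ unitSubmonoid k K) : L.log x⁻¹ = -L.log x := by
  have hx0 : x ≠ 0 := ne_zero_of_mem_unitSubmonoid hx
  have h := L.log_mul x hx x⁻¹ (inv_mem_unitSubmonoid hx)
  rw [mul_inv_cancel₀ hx0,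
    L.log_eq_zero_of_pow_eq_one (unitSubmonoid k K).one_mem one_pos (one_pow 1)] at h
  exact eq_neg_of_add_eq_zero_right h.symm

/-- **`ℐ*` IS the pre-log-shell, as a set**: `log_k̄(𝒪_k^×)` is already an additive subgroup of `k̄`
(`𝒪_k^×` is a group and `log_k̄` a homomorphism on it), so abc-iut-L4-t2's `preLogShell` (the subgroup it
GENERATES) has underlying set exactly `log_k̄(𝒪_k^×)`. [cite: MochizukiAbsTopIII2015, Def 5.4 (iii) p. 126] -/
theorem coe_preLogShell_eq_image : (L.preLogShell : Set K) = L.log '' invariantUnits k K := by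
  refine Set.Subset.antisymm ?_ AddSubgroup.subset_closure
  -- the image is (the carrier of) an additive subgroup
  let S : AddSubgroup K :=
    { carrier := L.log '' invariantUnits k K
      zero_mem' := ⟨1, ⟨(unitSubmonoid k K).one_mem, fun σ => smul_one σ⟩,
        L.log_eq_zero_of_pow_eq_one (unitSubmonoid k K).one_mem one_pos (one_pow 1)⟩
      add_mem' := by
        rintro _ _ ⟨x, hx, rfl⟩ ⟨y, hy, rfl⟩
        exact ⟨x * y, mul_mem_invariantUnits hx hy, L.log_mul x hx.1 y hy.1⟩
      neg_mem' := by
        rintro _ ⟨x, hx, rfl⟩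
        exact ⟨x⁻¹, inv_mem_invariantUnits hx, log_inv L hx.1⟩ }
  change ((L.preLogShell : AddSubgroup K) : Set K) ⊆ (S : Set K)
  exact SetLike.coe_subset_coe.mpr ((AddSubgroup.closure_le S).mpr subset_rfl)

/-- Hence: **the pre-log-shell of Def 3.1 (iv), read in `k̄`, is the image of `𝒪_k^×` via the shell-arrow of
Def 5.4 (iii) followed by `log_k̄`** ("`ℐ*` … i.e., in essence, the compact submodule constituted by the
pre-log-shell"). [cite: MochizukiAbsTopIII2015, Def 5.4 (iii) p. 126] -/
theorem coe_preLogShell_eq_image_invariantUnitClasses :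
    (L.preLogShell : Set K) =
      (fun y => Multiplicative.toAdd (L.logEquiv y)) '' invariantUnitClasses k K := by
  rw [toAdd_logEquiv_image_invariantUnitClasses, coe_preLogShell_eq_image]

/-! ## `ℐ = (p*)⁻¹ · ℐ* ⊆ (k~)^{Π_k}`: rescaled shells consist of Galois invariants -/

/-- **`ℐ ⊆ (k~)^{Π_k}`** (read in `k̄`): for any `c ∈ k` (print: `c = p*_k`), every element of
`c⁻¹ · ℐ*` is fixed by `G_k`. [cite: MochizukiAbsTopIII2015, Def 5.4 (iii) p. 126] -/
theorem smul_eq_self_of_mem_inv_smul_preLogShell (c : k) {y : K}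
    (hy : y ∈ (algebraMap k K c)⁻¹ • (L.preLogShell : Set K)) (σ : K ≃ₐ[k] K) : σ • y = y := by
  obtain ⟨z, hz, rfl⟩ := Set.mem_smul_set.mp hy
  rw [smul_eq_mul, smul_mul', AlgEquiv.smul_def, map_inv₀, AlgEquiv.commutes,
    L.smul_eq_self_of_mem_preLogShell hz σ]

/-- … hence, for an MLF `k` with algebraic closure `k̄` (Galois descent `k̄^{G_k} = k`, abc-iut-L6-d2's
`coe_preLogShell_subset_range_algebraMap`), `c⁻¹ · ℐ* ⊆ k ⊆ k̄` for every `c ∈ k` — in particular the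
log-shell `ℐ = (p*_k)⁻¹ · ℐ*` lies in (the image of) `k = (k~)^{Π_k}`.
[cite: MochizukiAbsTopIII2015, Def 5.4 (iii) p. 126] -/
theorem inv_smul_preLogShell_subset_range (C : MLFClosure.{u}) (L' : GaloisPadicLog C.k C.K) (c : C.k) :
    (algebraMap C.k C.K c)⁻¹ • (L'.preLogShell : Set C.K) ⊆ Set.range (algebraMap C.k C.K) := by
  rintro _ ⟨y, hy, rfl⟩
  obtain ⟨u, rfl⟩ := GaloisPadicLog.coe_preLogShell_subset_range_algebraMap C L' hy
  exact ⟨c⁻¹ * u, by simp [smul_eq_mul, map_mul, map_inv₀]⟩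

end ShellDiagram

end Literature.AnabelianGeometry.AbsoluteAnabelian

end
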